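import Literature.AlgebraicTopology.SingularHomology.EilenbergZilberChains
import HarnessLib

/-!
# Evaluating a cross product cochain on a shuffle product: only the straight shuffle survives

Topic `Literature/AlgebraicTopology/SingularHomology`. The combinatorial half of the classical
computation "Alexander–Whitney ∘ Eilenberg–Zilber = identity up to degenerate simplices"
(Eilenberg–Mac Lane 1953, Thm. 2.1a; Hatcher, *Algebraic Topology* (2002), §3.B p. 278–279, proof
that the simplicial and singular cross products agree): evaluate the **cross product cochain**
`(a ×' b)(ρ) = a(pr₁ ∘ front_k ρ) · b(pr₂ ∘ back_l ρ)` (`crossCochain`, i.e. `pr₁^* a ⌣ pr₂^* b` for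
the tree's Alexander–Whitney cup product `cochainCup`) on the **shuffle product** `σ × τ`
(`EilenbergZilber.ezMap`) of a `p`-simplex `σ` and a `q`-simplex `τ`, `p + q = k + l`.

Each shuffle simplex `ρ_w = (σ ∘ [e_{a₀},…], τ ∘ [e_{b₀},…])` contributes
`a(σ ∘ [e_{a₀},…,e_{a_k}]) · b(τ ∘ [e_{b_{n-l}},…,e_{bₙ}])`; along a lattice path the labels
`a₀, …, a_k` are pairwise distinct iff the first `k` steps go right, and `b_{n-l}, …, bₙ` are
pairwise distinct iff the last `l` steps go up. Hence **if `a` and `b` vanish on degenerate affine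
reparametrisations of `σ`, `τ`** (repeated vertex labels — e.g. integration cochains of differential
forms, the use in the sequel), only the straight path `R^p U^q` survives, it does so only when
`p = k`, and it carries the coefficient `+1` (`ShuffleChains.shuffle_apply_stdPath`):

`⟨a ×' b, σ × τ⟩ = [p = k] · a(σ) b(τ)`   (`cochainEval_crossCochain_ezMap`).

Also: the evaluation pairing `cochainEval φ c = ∑_σ c_σ φ(σ)` of function cochains on concrete
chains and its basic properties (`cochainEval_single`, `cochainEval_bd` = "`⟨φ, ∂c⟩ = ⟨δφ, c⟩`",
naturality `cochainEval_mapDomain`), and `crossCochain` versus the cup product of the pulled-back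
cochains (`crossCochain_eq_cochainCup`, `cochainCup_eq_crossCochain_diag`:
`(a ⌣ b)(σ) = (a ×' b)(σ, σ)`).

Everything is proved; no named facts.

## References

* S. Eilenberg, S. Mac Lane, On the groups `H(Π,n)`. I, Ann. of Math. 58 (1953), §2, §5. [folklore attribution]
* A. Hatcher, *Algebraic Topology*, CUP 2002, §3.B pp. 277–280, §3.2 p. 206. [HatcherAT2002]
-/

noncomputable section

-- see "Implementation notes" in `…SingularHomology.SingularChainsConcrete`
set_option backward.isDefEq.respectTransparency false

open CategoryTheory AlgebraicTopology

universe u v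

namespace Literature.AlgebraicTopology.SingularHomology

open ShuffleChains TupleChain SingularSimplex StdSimplex EilenbergZilber

variable {R : Type v} [CommRing R]
variable {X : Type u} [TopologicalSpace X] {Y : Type u} [TopologicalSpace Y] {Z : Type u} [TopologicalSpace Z]
  {p q k l n : ℕ}

/-! ### Evaluation of function cochains on concrete chains -/

/-- **The evaluation (Kronecker) pairing** of a cochain `φ : (Δⁿ → Z) → R` with a concrete chain
`c = ∑ c_σ σ`: `⟨φ, c⟩ = ∑_σ c_σ φ(σ)` (Hatcher (2002), §3.1 p. 198). [cite: HatcherAT2002, §3.1 p. 198] -/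
def cochainEval (φ : SingularSimplex Z n → R) : CChain R Z n →ₗ[R] R :=
  Finsupp.lsum R fun σ ↦ (LinearMap.id : R →ₗ[R] R).smulRight (φ σ)

/-- Evaluation on an elementary chain. [folklore] -/
@[simp]
theorem cochainEval_single (φ : SingularSimplex Z n → R) (σ : SingularSimplex Z n) (r : R) :
    cochainEval φ (Finsupp.single σ r) = r * φ σ := by
  rw [cochainEval, Finsupp.lsum_single, LinearMap.smulRight_apply, LinearMap.id_apply, smul_eq_mul]

/-- Evaluation as a sum over the support. [folklore] -/
theorem cochainEval_apply (φ : SingularSimplex Z n → R) (c : CChain R Z n) :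
    cochainEval φ c = c.sum fun σ r ↦ r * φ σ := by
  conv_lhs => rw [← Finsupp.sum_single c]
  rw [map_finsuppSum]
  exact Finsupp.sum_congr fun σ _ ↦ cochainEval_single φ σ _

/-- **`⟨φ, ∂c⟩ = ⟨δφ, c⟩`**: evaluation intertwines the concrete boundary and the singular
coboundary (Hatcher (2002), §3.1 p. 198). [cite: HatcherAT2002, §3.1 p. 198] -/
theorem cochainEval_bd (φ : SingularSimplex Z n → R) (c : CChain R Z (n + 1)) :
    cochainEval φ (csingularChainComplex.bd R n c) = cochainEval ((singularCochainComplex R R Z).d n (n + 1) φ) c := by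
  induction c using Finsupp.induction_linear with
  | zero => simp
  | add x y hx hy => simp only [map_add, hx, hy]
  | single σ r =>
    rw [csingularChainComplex.bd_single, map_sum, cochainEval_single, singularCochainComplex.d_apply, Finset.mul_sum]
    refine Finset.sum_congr rfl fun i _ ↦ ?_
    rw [map_smul, cochainEval_single, smul_eq_mul]
    ring

/-- **Naturality of evaluation**: `⟨φ, f♯ c⟩ = ⟨f^♯ φ, c⟩`. [folklore] -/
theorem cochainEval_mapDomain (φ : SingularSimplex Z n → R) (f : C(X, Z)) (c : CChain R X n) :
    cochainEval φ (Finsupp.mapDomain (fun σ : SingularSimplex X n ↦ σ.map f) c) = cochainEval (fun σ ↦ φ (σ.map f)) c := by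
  induction c using Finsupp.induction_linear with
  | zero => simp
  | add x y hx hy => simp only [Finsupp.mapDomain_add, map_add, hx, hy]
  | single σ r => rw [Finsupp.mapDomain_single, cochainEval_single, cochainEval_single]

/-- A cocycle evaluates to zero on boundaries. [folklore] -/
theorem cochainEval_bd_eq_zero_of_d_eq_zero {φ : SingularSimplex Z n → R}
    (hφ : (singularCochainComplex R R Z).d n (n + 1) φ = 0) (c : CChain R Z (n + 1)) :
    cochainEval φ (csingularChainComplex.bd R n c) = 0 := by
  rw [cochainEval_bd, hφ]
  induction c using Finsupp.induction_linear with
  | zero => simp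
  | add x y hx hy => simp only [map_add, hx, hy, add_zero]
  | single σ r => rw [cochainEval_single]; exact mul_zero r

/-! ### The cross product cochain -/

/-- **The cross product cochain** `a ×' b ∈ C^{k+l}(X × Y)` of `a ∈ Cᵏ(X)`, `b ∈ Cˡ(Y)`:
`(a ×' b)(ρ) = a(pr₁ ∘ ρ|[v₀…v_k]) · b(pr₂ ∘ ρ|[v_k…vₙ])`, i.e. `pr₁^♯ a ⌣ pr₂^♯ b` for the
Alexander–Whitney cup product (Hatcher (2002), §3.2 p. 210 / p. 218, "cross product
`a × b = p₁^* a ⌣ p₂^* b`"). [cite: HatcherAT2002, §3.2 p. 218] -/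
def crossCochain (h : k + l = n) (a : SingularSimplex X k → R) (b : SingularSimplex Y l → R) :
    SingularSimplex (X × Y) n → R :=
  cochainCup h (fun ρ ↦ a (ρ.map ⟨Prod.fst, continuous_fst⟩)) (fun ρ ↦ b (ρ.map ⟨Prod.snd, continuous_snd⟩))

/-- The cross product cochain is the cup product of the pulled-back cochains. [cite: HatcherAT2002, §3.2 p. 218] -/
theorem crossCochain_eq_cochainCup (h : k + l = n) (a : SingularSimplex X k → R) (b : SingularSimplex Y l → R) :
    crossCochain h a b = cochainCup h ((singularCochainComplex.map R R (⟨Prod.fst, continuous_fst⟩ : C(X × Y, X))).f k a)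
      ((singularCochainComplex.map R R (⟨Prod.snd, continuous_snd⟩ : C(X × Y, Y))).f l b) :=
  rfl

/-- The cross product cochain on an elementary simplex. [folklore] -/
theorem crossCochain_apply (h : k + l = n) (a : SingularSimplex X k → R) (b : SingularSimplex Y l → R)
    (ρ : SingularSimplex (X × Y) n) : crossCochain h a b ρ =
      a ((ρ.frontFace (by omega)).map ⟨Prod.fst, continuous_fst⟩) * b ((ρ.backFace (by omega)).map ⟨Prod.snd, continuous_snd⟩) := by
  rw [crossCochain, cochainCup_apply]

/-- On a pair simplex the cross product cochain reads off the components: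
`(a ×' b)(σ, τ) = a(front σ) b(back τ)`. [folklore] -/
theorem crossCochain_pairSimplex (h : k + l = n) (a : SingularSimplex X k → R) (b : SingularSimplex Y l → R)
    (σ : SingularSimplex X n) (τ : SingularSimplex Y n) : crossCochain h a b (pairSimplex σ τ) =
      a (σ.frontFace (by omega)) * b (τ.backFace (by omega)) := by
  rw [crossCochain_apply, pairSimplex_frontFace, pairSimplex_backFace, pairSimplex_map_fst, pairSimplex_map_snd]

/-- **Cup product = cross product on the diagonal**: `(a ⌣ b)(σ) = (a ×' b)(σ, σ)`
(Hatcher (2002), §3.2 p. 218: `a ⌣ b = Δ^*(a × b)`). [cite: HatcherAT2002, §3.2 p. 218] -/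
theorem cochainCup_eq_crossCochain_diag (h : k + l = n) (a : SingularSimplex X k → R) (b : SingularSimplex X l → R)
    (σ : SingularSimplex X n) : cochainCup h a b σ = crossCochain h a b (pairSimplex σ σ) := by
  rw [cochainCup_apply, crossCochain_pairSimplex]

/-! ### Injective label maps along lattice paths -/

/-- An injective map `u : Fin (k+1) → ℕ` with `u j ≤ j` is the inclusion `j ↦ j`. [folklore] -/
theorem eq_val_of_injective_of_le {u : Fin (k + 1) → ℕ} (hinj : Function.Injective u) (hle : ∀ j, u j ≤ (j : ℕ))
    (j : Fin (k + 1)) : u j = (j : ℕ) := by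
  obtain ⟨m, hm⟩ : ∃ m, (j : ℕ) = m := ⟨_, rfl⟩
  induction m using Nat.strong_induction_on generalizing j with
  | _ m ih =>
    rcases (hle j).lt_or_eq with hlt | heq
    · exfalso
      have hi : u j < k + 1 := lt_of_lt_of_le hlt (by have := j.2; omega)
      have huu : u ⟨u j, hi⟩ = u j := ih (u j) (hm ▸ hlt) ⟨u j, hi⟩ rfl
      have hij := congrArg Fin.val (hinj huu)
      simp only at hij
      omega
    · omega

/-! ### The evaluation of a cross cochain on a shuffle product -/

section Eval

variable {a : SingularSimplex X k → R} {b : SingularSimplex Y l → R}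

/-- Front labels of the shuffle simplex of a tuple `w`: the first coordinates of `w₀, …, w_k`. [folklore] -/
def frontLabels (h : k ≤ n) (w : Fin (n + 1) → V) : Fin (k + 1) → ℕ := fun j ↦ (w (Fin.castLE (by omega) j)).1

/-- Back labels of the shuffle simplex of a tuple `w`: the second coordinates of `w_{n-l}, …, wₙ`. [folklore] -/
def backLabels (h : l ≤ n) (w : Fin (n + 1) → V) : Fin (l + 1) → ℕ := fun j ↦ (w ⟨(j : ℕ) + (n - l), by omega⟩).2

/-- The first component of the front face of a tuple simplex is `σ` reparametrised along the front
labels. [folklore] -/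
theorem frontFace_tupleSimplex_map_fst (h : k ≤ n) (σ : SingularSimplex X p) (τ : SingularSimplex Y q)
    (w : Fin (n + 1) → V) :
    ((tupleSimplex σ τ w).frontFace h).map ⟨Prod.fst, continuous_fst⟩ = σ.compose fun j ↦ vtx p (frontLabels h w j) := by
  rw [tupleSimplex, pairSimplex_frontFace, pairSimplex_map_fst, frontFace_eq_compose, compose_compose]
  congr 1
  funext j
  rw [vtx_eq_vertex (show (j : ℕ) ≤ n by omega), affComb_vertex]
  rfl

/-- The second component of the back face of a tuple simplex is `τ` reparametrised along the back
labels. [folklore] -/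
theorem backFace_tupleSimplex_map_snd (h : l ≤ n) (σ : SingularSimplex X p) (τ : SingularSimplex Y q)
    (w : Fin (n + 1) → V) :
    ((tupleSimplex σ τ w).backFace h).map ⟨Prod.snd, continuous_snd⟩ = τ.compose fun j ↦ vtx q (backLabels h w j) := by
  rw [tupleSimplex, pairSimplex_backFace, pairSimplex_map_snd, backFace_eq_compose, compose_compose]
  congr 1
  funext j
  rw [vtx_eq_vertex (show (j : ℕ) + (n - l) ≤ n by omega), affComb_vertex]
  rfl

/-- **Along a tuple of `shuffle n p` with injective front labels (`k + 1` of them), the first `k`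
steps go right**: `(w j).1 = j` for `j ≤ k`; in particular `k ≤ p`. [folklore] -/
theorem fst_eq_of_injective_frontLabels (h : k ≤ n) {w : Fin (n + 1) → V} (hw : w ∈ (shuffle n p).support)
    (hinj : Function.Injective (frontLabels h w)) (j : Fin (n + 1)) (hj : (j : ℕ) ≤ k) : (w j).1 = (j : ℕ) := by
  have hle : ∀ i : Fin (k + 1), frontLabels h w i ≤ (i : ℕ) := fun i ↦ by
    have := fst_le_of_mem_support_shuffle hw (Fin.castLE (by omega) i)
    exact this
  have := eq_val_of_injective_of_le hinj hle ⟨j, by omega⟩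
  exact this

/-- **Along a tuple of `shuffle n p` with injective back labels (`l + 1` of them), the last `l`
steps go up**: the second coordinate increases by exactly one at each of the last `l` steps. [folklore] -/
theorem snd_eq_of_injective_backLabels (h : l ≤ n) {w : Fin (n + 1) → V} (hw : w ∈ (shuffle n p).support)
    (hinj : Function.Injective (backLabels h w)) :
    ∀ m : ℕ, ∀ hm : m ≤ l, (w ⟨m + (n - l), by omega⟩).2 = (w ⟨n - l, by omega⟩).2 + m
  | 0, _ => by simp
  | m + 1, hm => by
    have ih := snd_eq_of_injective_backLabels h hw hinj m (by omega)
    -- the step from index `m + (n - l)` to `m + 1 + (n - l)`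
    have hstep := fst_succ_le_of_mem_support_shuffle hw ⟨m + (n - l), by omega⟩
    have hsum1 := fst_add_snd_of_mem_support_shuffle hw (⟨m + (n - l), by omega⟩ : Fin (n + 1))
    have hsum2 := fst_add_snd_of_mem_support_shuffle hw (⟨m + 1 + (n - l), by omega⟩ : Fin (n + 1))
    have hcs : ((⟨m + (n - l), by omega⟩ : Fin n).castSucc : Fin (n + 1)) = ⟨m + (n - l), by omega⟩ := rfl
    have hsc : ((⟨m + (n - l), by omega⟩ : Fin n).succ : Fin (n + 1)) = ⟨m + 1 + (n - l), by omega⟩ :=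
      Fin.ext (by simp; omega)
    rw [hcs, hsc] at hstep
    change (w ⟨m + (n - l), _⟩).1 + (w ⟨m + (n - l), _⟩).2 = m + (n - l) at hsum1
    change (w ⟨m + 1 + (n - l), _⟩).1 + (w ⟨m + 1 + (n - l), _⟩).2 = m + 1 + (n - l) at hsum2
    rcases Nat.eq_or_lt_of_le hstep.1 with heq | hlt
    · -- vertical step: second coordinate `+1`
      omega
    · -- horizontal step: second coordinate unchanged, contradicting injectivity of the back labels
      exfalso
      have h2 : (w ⟨m + 1 + (n - l), by omega⟩).2 = (w ⟨m + (n - l), by omega⟩).2 := by omega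
      have : backLabels h w ⟨m + 1, by omega⟩ = backLabels h w ⟨m, by omega⟩ := h2
      have := congrArg Fin.val (hinj this)
      simp at this

/-- **Only the straight path has injective front AND back labels**, and then `p = k`: for a tuple
`w` of `shuffle n p` (`p + q = n = k + l`) with injective front `k`-labels and back `l`-labels,
`p = k` and `w = stdPath n p`. [folklore] -/
theorem eq_stdPath_of_injective_labels (hn : p + q = n) (hkl : k + l = n) {w : Fin (n + 1) → V}
    (hw : w ∈ (shuffle n p).support) (hF : Function.Injective (frontLabels (show k ≤ n by omega) w))
    (hB : Function.Injective (backLabels (show l ≤ n by omega) w)) : p = k ∧ w = stdPath n p := by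
  have hfront : ∀ j : Fin (n + 1), (j : ℕ) ≤ k → (w j).1 = (j : ℕ) := fst_eq_of_injective_frontLabels _ hw hF
  have hlast := snd_eq_of_injective_backLabels (show l ≤ n by omega) hw hB l le_rfl
  -- endpoint: `(w n).1 = p`
  have hend := fst_add_snd_of_mem_support_shuffle hw (Fin.last n)
  have hbox := vertsIn_shuffle n p w hw (Fin.last n)
  simp only [box, Set.mem_setOf_eq, Fin.val_last] at hbox hend
  -- at index `k = n - l`: first coordinate is `k`, so second is `0`
  have hk : (w ⟨n - l, by omega⟩).1 = n - l := hfront ⟨n - l, by omega⟩ (by simp only; omega)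
  have hk2 : (w ⟨n - l, by omega⟩).2 = 0 := by
    have := fst_add_snd_of_mem_support_shuffle hw ⟨n - l, by omega⟩
    simp only at this
    omega
  have hidx : (⟨l + (n - l), by omega⟩ : Fin (n + 1)) = Fin.last n := Fin.ext (by simp; omega)
  rw [hidx, hk2, zero_add] at hlast
  have hpk : p = k := by omega
  exact ⟨hpk, eq_stdPath_of_mem_support_shuffle hw fun j hj ↦ hfront j (by omega)⟩

/-- Front labels of the straight path `R^k U^l` are `0, 1, …, k`. [folklore] -/
theorem frontLabels_stdPath (h : k ≤ n) (j : Fin (k + 1)) : frontLabels h (stdPath n k) j = (j : ℕ) := by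
  simp only [frontLabels, stdPath_apply, Fin.val_castLE]
  exact Nat.min_eq_left (Nat.lt_succ_iff.mp j.2)

/-- Back labels of the straight path `R^k U^l` (`k + l = n`) are `0, 1, …, l`. [folklore] -/
theorem backLabels_stdPath (hkl : k + l = n) (j : Fin (l + 1)) : backLabels (show l ≤ n by omega) (stdPath n k) j = (j : ℕ) := by
  simp only [backLabels, stdPath_apply]
  rw [Nat.min_eq_right (by omega)]
  omega

/-- The term of a single shuffle simplex in `⟨a ×' b, σ × τ⟩`: for a tuple `w` of `shuffle n p` it
vanishes unless `p = k` and `w` is the straight path (given that `a`, `b` vanish on degenerate affine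
reparametrisations). [folklore] -/
theorem crossCochain_tupleSimplex_eq_zero (hn : p + q = n) (hkl : k + l = n) (σ : SingularSimplex X p)
    (τ : SingularSimplex Y q)
    (ha : ∀ u : Fin (k + 1) → ℕ, (∀ j, u j ≤ p) → ¬Function.Injective u → a (σ.compose fun j ↦ vtx p (u j)) = 0)
    (hb : ∀ u : Fin (l + 1) → ℕ, (∀ j, u j ≤ q) → ¬Function.Injective u → b (τ.compose fun j ↦ vtx q (u j)) = 0)
    {w : Fin (n + 1) → V} (hw : w ∈ (shuffle n p).support) (hne : ¬(p = k ∧ w = stdPath n p)) :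
    crossCochain hkl a b (tupleSimplex σ τ w) = 0 := by
  rw [crossCochain_apply, frontFace_tupleSimplex_map_fst, backFace_tupleSimplex_map_snd]
  have hbox := vertsIn_shuffle n p w hw
  have hqn : n - p = q := by omega
  by_cases hF : Function.Injective (frontLabels (show k ≤ n by omega) w)
  · by_cases hB : Function.Injective (backLabels (show l ≤ n by omega) w)
    · exact absurd (eq_stdPath_of_injective_labels hn hkl hw hF hB) hne
    · rw [hb (backLabels (show l ≤ n by omega) w) (fun j ↦ hqn ▸ (hbox _).2) hB, mul_zero]
  · rw [ha (frontLabels (show k ≤ n by omega) w) (fun j ↦ (hbox _).1) hF, zero_mul]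

/-- **The evaluation of a cross cochain on a shuffle product, mismatched degrees**: if `p ≠ k`
(`p + q = k + l = n`) and `a`, `b` vanish on degenerate affine reparametrisations of `σ`, `τ`, then
`⟨a ×' b, σ × τ⟩ = 0` (Eilenberg–Mac Lane (1953), proof of Thm. 2.1a; Hatcher (2002), §3.B pp. 278–279).
[cite: HatcherAT2002, §3.B pp. 277–280] -/
theorem cochainEval_crossCochain_ezMap_of_ne (hn : p + q = n) (hkl : k + l = n) (hpk : p ≠ k)
    (σ : SingularSimplex X p) (τ : SingularSimplex Y q)
    (ha : ∀ u : Fin (k + 1) → ℕ, (∀ j, u j ≤ p) → ¬Function.Injective u → a (σ.compose fun j ↦ vtx p (u j)) = 0)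
    (hb : ∀ u : Fin (l + 1) → ℕ, (∀ j, u j ≤ q) → ¬Function.Injective u → b (τ.compose fun j ↦ vtx q (u j)) = 0)
    (r : R) : cochainEval (crossCochain hkl a b) (ezMap R R n σ τ r) = 0 := by
  classical
  rw [ezMap, realize₂_eq_sum, map_finsuppSum, Finsupp.sum]
  refine Finset.sum_eq_zero fun w hw ↦ ?_
  rw [map_zsmul, cochainEval_single, crossCochain_tupleSimplex_eq_zero hn hkl σ τ ha hb hw fun h ↦ hpk h.1,
    mul_zero, smul_zero]

/-- **The evaluation of a cross cochain on a shuffle product, matched degrees.** Let `a ∈ Cᵏ(X)`,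
`b ∈ Cˡ(Y)` vanish on the degenerate affine reparametrisations (repeated vertex labels) of the
`k`-simplex `σ`, resp. the `l`-simplex `τ`, and `k + l = n`. Then `⟨a ×' b, σ × τ⟩ = a(σ) b(τ)`:
among the shuffle simplices only the straight one `R^k U^l` has non-degenerate front `k`-face in `X`
and back `l`-face in `Y`, and it has coefficient `+1` (Eilenberg–Mac Lane (1953), proof of
Thm. 2.1a "`f∇ = 1`" modulo degeneracies; Hatcher (2002), §3.B pp. 278–279).
[cite: HatcherAT2002, §3.B pp. 277–280] -/
theorem cochainEval_crossCochain_ezMap (hkl : k + l = n) (σ : SingularSimplex X k) (τ : SingularSimplex Y l)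
    (ha : ∀ u : Fin (k + 1) → ℕ, (∀ j, u j ≤ k) → ¬Function.Injective u → a (σ.compose fun j ↦ vtx k (u j)) = 0)
    (hb : ∀ u : Fin (l + 1) → ℕ, (∀ j, u j ≤ l) → ¬Function.Injective u → b (τ.compose fun j ↦ vtx l (u j)) = 0)
    (r : R) : cochainEval (crossCochain hkl a b) (ezMap R R n σ τ r) = r * (a σ * b τ) := by
  classical
  rw [ezMap, realize₂_eq_sum, map_finsuppSum, Finsupp.sum]
  have hmem : stdPath n k ∈ (shuffle n k).support := by
    rw [Finsupp.mem_support_iff, shuffle_apply_stdPath (by omega)]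
    exact one_ne_zero
  rw [← Finset.add_sum_erase _ _ hmem, Finset.sum_eq_zero fun w hw ↦ ?_, add_zero]
  · rw [map_zsmul, cochainEval_single, shuffle_apply_stdPath (by omega), one_smul, crossCochain_apply,
      frontFace_tupleSimplex_map_fst, backFace_tupleSimplex_map_snd]
    congr 2
    · congr 1
      conv_rhs => rw [← compose_vtx_val σ]
      congr 1; funext j; rw [frontLabels_stdPath]
    · congr 1
      conv_rhs => rw [← compose_vtx_val τ]
      congr 1; funext j; rw [backLabels_stdPath hkl]
  · obtain ⟨hne, hw'⟩ := Finset.mem_erase.mp hw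
    rw [map_zsmul, cochainEval_single, crossCochain_tupleSimplex_eq_zero hkl hkl σ τ ha hb hw' fun h ↦ hne h.2, mul_zero,
      smul_zero]

end Eval

end Literature.AlgebraicTopology.SingularHomology
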